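import Summits.MatrixMultiplication.OmegaCensus.DicyclicNoCubeLaw
import Summits.MatrixMultiplication.OmegaCensus.DihedralLawModOneNonCube
import HarnessLib

/-!
# The `|A| ≡ 1 (mod 3)` law classification is COMPLETE for dicyclic-type groups

ω-census `pub-omega`, family (b3), seat pub-omega-group gen 7.  Framing: lottery ticket; floor = certified bounds/negative
ranges.  VALUE: a theorem about the group-theoretic method (TPP triples in dihedral-like groups); NOT progress on ω.

The census's classification claim (FAMILY-B-ADDENDUM-g4/g5/g6): for a dihedral-like group `G` over a finite abelian `A` with
`|A| ≡ 1 (mod 3)`, `|A| ≥ 14`, a TPP triple attaining the law `3|S||T||U| + 8 = 8|A|` exists only if `A` has an element of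
order `≥ |A|/2`.  It was a theorem for every NON-cube law shape (`DihedralLawModOneNonCube.two_cosets_of_mod_one_law_of_not_cube`,
any `c₀`) and for all `A` of `2`-rank `≥ 3` (`DihedralLawModOneRankThreeAll`); the cube shapes over `A` of `2`-rank `≤ 2` were
being settled order by order by structured computation.

**Theorem (`card_le_two_mul_addOrderOf_of_mod_one_law_of_c0_ne_zero`).** If `c₀ ≠ 0` (dicyclic type: generalized
dicyclic groups `Q_{4n}` and their relatives over non-cyclic `A`), EVERY law triple forces `A = (a + ⟨g⟩) ∪ (b + ⟨g⟩)`
(`two_cosets_of_mod_one_law_of_c0_ne_zero`), hence an element `g` with `|A| ≤ 2·ord(g)`.  Proof: cube shapes do not occur at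
all when `c₀ ≠ 0` (`DicyclicNoCubeLaw.no_cube_law_of_c0_ne_zero`); non-cube shapes give two cosets.  Consequently
(`no_mod_one_law_of_c0_ne_zero_of_small_orders`) a dicyclic-type group over an `A` all of whose elements have order
`< |A|/2` attains no law — for EVERY such `A`, with no computation: the open part of the classification is confined to the
generalized dihedral groups `Dih(A)` (`c₀ = 0`).
-/

namespace Summit.MatrixMultiplication.OmegaCensus

open Literature.Combinatorics.Additive Finset

section DihedralLike

variable {A : Type*} [AddCommGroup A] [DecidableEq A] [Fintype A] {G : Type} [Group G] [DecidableEq G]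
  {ρ τ : A → G} {c₀ : A} {S T U : Finset G}

/-- **Dicyclic type, `|A| ≡ 1 (mod 3)`, `|A| ≥ 14`: every law triple makes `A` the union of two cosets of a cyclic
subgroup.** [folklore] -/
theorem two_cosets_of_mod_one_law_of_c0_ne_zero
    (hρρ : ∀ a b, ρ a * ρ b = ρ (a + b)) (hρτ : ∀ a b, ρ a * τ b = τ (b - a))
    (hτρ : ∀ a b, τ a * ρ b = τ (a + b)) (hττ : ∀ a b, τ a * τ b = ρ (c₀ + b - a)) (hc₀ : c₀ ≠ 0)
    (hρ : Function.Injective ρ) (hτ : Function.Injective τ) (hne : ∀ a b, ρ a ≠ τ b)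
    (hsurj : ∀ g, (∃ a, ρ a = g) ∨ (∃ a, τ a = g)) (hmod : Fintype.card A % 3 = 1) (hA : 14 ≤ Fintype.card A)
    (h : TripleProductProperty S T U) (hV : 3 * (S.card * T.card * U.card) + 8 = 8 * Fintype.card A) :
    ∃ g a b : A, ∀ x : A, x - a ∈ AddSubgroup.zmultiples g ∨ x - b ∈ AddSubgroup.zmultiples g := by
  by_cases hnc : ((univ.filter fun a : A => ρ a ∈ S).card = (univ.filter fun a : A => τ a ∈ S).card ∧
      (univ.filter fun a : A => ρ a ∈ T).card = (univ.filter fun a : A => τ a ∈ T).card ∧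
      (univ.filter fun a : A => ρ a ∈ U).card = (univ.filter fun a : A => τ a ∈ U).card)
  · exact (no_cube_law_of_c0_ne_zero hρρ hρτ hτρ hττ hc₀ hρ hτ hne hsurj h hnc.1 hnc.2.1 hnc.2.2 hV).elim
  · exact two_cosets_of_mod_one_law_of_not_cube hρρ hρτ hτρ hττ hρ hτ hne hsurj hmod hA h hV hnc

/-- **Dicyclic type: the law forces an element of order `≥ |A|/2`** (`|A| ≡ 1 (mod 3)`, `|A| ≥ 14`). [folklore] -/
theorem card_le_two_mul_addOrderOf_of_mod_one_law_of_c0_ne_zero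
    (hρρ : ∀ a b, ρ a * ρ b = ρ (a + b)) (hρτ : ∀ a b, ρ a * τ b = τ (b - a))
    (hτρ : ∀ a b, τ a * ρ b = τ (a + b)) (hττ : ∀ a b, τ a * τ b = ρ (c₀ + b - a)) (hc₀ : c₀ ≠ 0)
    (hρ : Function.Injective ρ) (hτ : Function.Injective τ) (hne : ∀ a b, ρ a ≠ τ b)
    (hsurj : ∀ g, (∃ a, ρ a = g) ∨ (∃ a, τ a = g)) (hmod : Fintype.card A % 3 = 1) (hA : 14 ≤ Fintype.card A)
    (h : TripleProductProperty S T U) (hV : 3 * (S.card * T.card * U.card) + 8 = 8 * Fintype.card A) :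
    ∃ g : A, Fintype.card A ≤ 2 * addOrderOf g := by
  obtain ⟨g, a, b, hab⟩ :=
    two_cosets_of_mod_one_law_of_c0_ne_zero hρρ hρτ hτρ hττ hc₀ hρ hτ hne hsurj hmod hA h hV
  exact ⟨g, card_le_two_mul_addOrderOf_of_two_cosets hab⟩

/-- **No law in a dicyclic-type group over an `A` with all element orders `< |A|/2`** (`|A| ≡ 1 (mod 3)`, `|A| ≥ 14`;
e.g. over `ℤ₁₀², ℤ₄×ℤ₅², ℤ₈², ℤ₄×ℤ₁₆, ℤ_p², ℤ₄×ℤ₈×ℤ₁₁, …` with any `c₀` of order two). [folklore] -/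
theorem no_mod_one_law_of_c0_ne_zero_of_small_orders
    (hρρ : ∀ a b, ρ a * ρ b = ρ (a + b)) (hρτ : ∀ a b, ρ a * τ b = τ (b - a))
    (hτρ : ∀ a b, τ a * ρ b = τ (a + b)) (hττ : ∀ a b, τ a * τ b = ρ (c₀ + b - a)) (hc₀ : c₀ ≠ 0)
    (hρ : Function.Injective ρ) (hτ : Function.Injective τ) (hne : ∀ a b, ρ a ≠ τ b)
    (hsurj : ∀ g, (∃ a, ρ a = g) ∨ (∃ a, τ a = g)) (hmod : Fintype.card A % 3 = 1) (hA : 14 ≤ Fintype.card A)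
    (hord : ∀ g : A, 2 * addOrderOf g < Fintype.card A) (h : TripleProductProperty S T U) :
    3 * (S.card * T.card * U.card) + 8 ≠ 8 * Fintype.card A := by
  intro hV
  obtain ⟨g, hg⟩ := card_le_two_mul_addOrderOf_of_mod_one_law_of_c0_ne_zero hρρ hρτ hτρ hττ hc₀ hρ hτ hne hsurj
    hmod hA h hV
  exact absurd (hord g) (not_lt.2 hg)

end DihedralLike

end Summit.MatrixMultiplication.OmegaCensus
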